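import Literature.NumberTheory.Transcendental.RoyPadicRankThm1
import HarnessLib

/-!
# Roy 1992 for `K = ℚ̄_p`: discharge of Corollary 1 and Theorem 5 (and the `p`-adic strong six exponentials theorem)

Topic `Literature/NumberTheory/Transcendental` (namespace `Literature.NumberTheory.Transcendental`).
Discharge companion (theorem-only: no definitions, no named facts) of
`Literature/NumberTheory/Transcendental/RoyPadicRank.lean`, whose named facts are Roy's Theorem 4
(`roy1992_padic_thm4`), Theorem 5 (`roy1992_padic_thm5`) and Corollary 1 (`roy1992_padic_cor1`) for
the `p`-adic field `K = ℚ̄_p = PadicAlgCl p`, `ℚ̄ = padicQbar p`, `𝓛̃ = RoyPadic.logLinearForms p`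
([Roy1992], Notations p. 24, §4 Theorem 4 p. 34, Corollary 1 and Corollary 2 p. 38, §5 Theorem 5
p. 39). Source read from the materialised text of [Roy1992] (PDF pp. 3–4 = journal pp. 24–25,
pp. 13–17 = journal pp. 34–38, pp. 18–19 = journal pp. 39–40).

The whole printed chain is now PROVED in the tree:

* Theorem 1 for `ℚ̄_p` (M. Waldschmidt's Theorem 4.1 of [Waldschmidt1988] for
  `G_a^{d₀} × G_m^{d₁}` over `ℂ_p`, in Roy's formulation, [Roy1992, §1 p. 25]):
  `RoyPadic.thm1_holds` (`RoyPadicRankThm1.lean`: the `p`-adic transcendence proof with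
  Philippon's zero estimate `LinGroup.zeroEstimate`);
* Theorem 1 ⇒ Theorem 2 ⇒ Theorem 4 ([Roy1992, §§2–4]): `roy1992_padic_thm4_of_waldschmidt`
  (`RoyPadicRankThm4OfWaldschmidt.lean`, on the field-generic `RoyRankGeneric*.lean`), whence
  `roy1992_padic_thm4_holds` (`RoyPadicRankThm1.lean`);
* Theorem 4 ⇒ Corollary 1 ([Roy1992, §4 p. 38]): `roy1992_padic_cor1_of_thm4`
  (`RoyPadicRankProofs.lean`); Theorem 4 ⇒ Theorem 5 ([Roy1992, §5 pp. 39–40]):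
  `roy1992_padic_thm5_of_thm4` (`RoyPadicRankThm5Proofs.lean`); Corollary 1 ⇒ Corollary 2
  ([Roy1992, §4 p. 38]): `roy1992_padic_strongSixExponentials_of_cor1` (`RoyPadicRank.lean`).

This file only composes them (it cannot live in `RoyPadicRankProofs.lean` or
`RoyPadicRankThm5Proofs.lean`, which are imported by `RoyPadicRankThm1.lean`):

* `roy1992_padic_cor1_holds : roy1992_padic_cor1 p` — **Corollary 1** [Roy1992, §4 Corollary 1
  (p. 38)]: "Let `M` be a `d × l` matrix with coefficients in `𝓛̃`, with `d > 0` and `l > 0`. Then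
  `rank(M) ≥ θ̃(M)·d/(1 + θ̃(M))`";
* `roy1992_padic_thm5_holds : roy1992_padic_thm5 p` — **Theorem 5** [Roy1992, §5 Theorem 5
  (p. 39)]: "`0 < n < d` and `dim_ℚ̄(U ∩ 𝓛̃^d) ≤ φ(n, d)`" for `U ∩ ℚ̄^d = 0`, `K^d` the smallest
  `ℚ̄`-rational subspace containing `U`;
* `roy1992_padic_strongSixExponentials` — **Corollary 2**, the `p`-adic strong six exponentials
  theorem [Roy1992, §4 Corollary 2 (p. 38)]: "Let `M` be a `2 × 3` matrix with coefficients in `𝓛̃`.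
  Assume that its rows are linearly independent over `ℚ̄` and that its columns are linearly
  independent over `ℚ̄`. Then the rank of `M` is `2`" — now unconditional.

## References

* [Roy1992] D. Roy, *Matrices whose coefficients are linear forms in logarithms*, J. Number Theory
  41 (1992) 22–47, doi:10.1016/0022-314x(92)90081-y: Notations (p. 24); §1 Theorem 1 (p. 25);
  §4 Theorem 4 (p. 34), Corollary 1, Corollary 2 (p. 38); §5 Theorem 5 (p. 39).
* [Waldschmidt1988] M. Waldschmidt, *On the transcendence methods of Gel'fond and Schneider in
  several variables*, in: New Advances in Transcendence Theory (A. Baker ed.), Cambridge Univ.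
  Press 1988, 375–398, Theorem 4.1 — via `RoyPadicRankThm1.lean`.
-/

namespace Literature.NumberTheory.Transcendental

open RoyPadic

variable (p : ℕ) [Fact p.Prime]

/-- **Roy 1992, §4 Corollary 1 for `K = ℚ̄_p` holds**: for a `d × l` matrix `M` (`d, l > 0`) with
coefficients in `𝓛̃ = ℚ̄ + ℚ̄·L` (linear forms in `p`-adic logarithms of algebraic numbers with
algebraic coefficients), `rank(M) ≥ θ̃(M)·d/(1 + θ̃(M))`. Discharge of the named fact
`roy1992_padic_cor1`: Theorem 4 ⇒ Corollary 1 (`roy1992_padic_cor1_of_thm4`, the printed proof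
p. 38) applied to Theorem 4 for `ℚ̄_p` (`roy1992_padic_thm4_holds`).
[cite: Roy1992, §4 Corollary 1 (p. 38); §4 Theorem 4 (p. 34); §1 Theorem 1 (p. 25)] -/
theorem roy1992_padic_cor1_holds : roy1992_padic_cor1 p :=
  roy1992_padic_cor1_of_thm4 p (roy1992_padic_thm4_holds p)

/-- **Roy 1992, §5 Theorem 5 for `K = ℚ̄_p` holds**: for a `K`-subspace `U ⊆ K^d` with
`U ∩ ℚ̄^d = 0` such that `K^d` is the smallest `ℚ̄`-rational subspace containing `U`, one has
`0 < n = dim_K U < d` and `dim_ℚ̄(U ∩ 𝓛̃^d) ≤ φ(n, d)`. Discharge of the named fact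
`roy1992_padic_thm5`: Theorem 4 ⇒ Theorem 5 (`roy1992_padic_thm5_of_thm4`, the printed proof
pp. 39–40) applied to Theorem 4 for `ℚ̄_p` (`roy1992_padic_thm4_holds`).
[cite: Roy1992, §5 Theorem 5 (p. 39); §4 Theorem 4 (p. 34); §1 Theorem 1 (p. 25)] -/
theorem roy1992_padic_thm5_holds : roy1992_padic_thm5 p :=
  roy1992_padic_thm5_of_thm4 p (roy1992_padic_thm4_holds p)

/-- **The `p`-adic strong six exponentials theorem (Roy 1992, §4 Corollary 2 for `K = ℚ̄_p`),
unconditionally**: "Let `M` be a `2 × 3` matrix with coefficients in `𝓛̃`. Assume that its rows are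
linearly independent over `ℚ̄` and that its columns are linearly independent over `ℚ̄`. Then the rank
of `M` is `2`." Corollary 1 ⇒ Corollary 2 (`roy1992_padic_strongSixExponentials_of_cor1`, the
printed proof p. 38) applied to `roy1992_padic_cor1_holds`.
[cite: Roy1992, §4 Corollary 2 and its proof (p. 38)] -/
theorem roy1992_padic_strongSixExponentials
    (M : Matrix (Fin 2) (Fin 3) (PadicAlgCl p)) (hM : ∀ i j, M i j ∈ logLinearForms p)
    (hrows : LinearIndependent (padicQbar p) (fun i => M i))
    (hcols : LinearIndependent (padicQbar p) (fun j => M.transpose j)) : M.rank = 2 :=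
  roy1992_padic_strongSixExponentials_of_cor1 p (roy1992_padic_cor1_holds p) M hM hrows hcols

end Literature.NumberTheory.Transcendental
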